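import Summits.KontsevichZagierPeriods.KontsevichZagierPeriods.Theorems.ComplexOrientationsCauchyMoveAlgGraph

/-!
# Route `ComplexOrientations`, support item `CauchyMove` (stmt-KontsevichZagierPeriods-11370):
# algebraic holomorphic germs are `ℚ`-semialgebraic — part 2 (the graph)

Helper file (prover-owned, `--supports CauchyMove`), continuing
`ComplexOrientationsCauchyMoveAlgGraph.lean`. **Theorem** (`isSemialgebraic_graph`): if `g` is
holomorphic on the disc `‖t‖ < R₁` (`R₁ ∈ ℚ`) and `P(g t, t) = 0` there for some non-zero
`P ∈ ℚ[w, t]`, then the graph `{(t, g t)} ⊆ ℂ² ≅ ℝ⁴` is a `ℚ`-semialgebraic subset of `ℝ⁴`.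

Proof (inside the tree's semialgebraic geometry over `ℚ`): after the minimal-degree reduction
(`exists_goodPoly`) the ramification function `f(t) = ∂P/∂w (g t, t)` is a non-zero analytic
function on the disc. (1) Off its zeros the graph is relatively open in the `ℚ`-semialgebraic set
`X' = {P = 0, ∂P/∂w ≠ 0, ‖t‖ < R₁}` by the holomorphic implicit function theorem
(`exists_implicitChart`; local uniqueness of the branch, `exists_nhd_inter_subset`) and relatively
closed (continuity of `g`); since `X'` is a finite union of connected `ℚ`-semialgebraic cells
(`IsSemialgebraic.exists_finset_isConnected_sUnion_eq`, Basu–Pollack–Roy Thm. 5.21), the graph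
off the zeros of `f` is the union of the cells it meets (`isSemialgebraic_graph_off`). (2) The zeros
of `f` are nowhere dense in the disc (identity principle, `dense_good`), so the full graph is
`closure (graph off the zeros) ∩ {‖t‖ < R₁}` (`graph_eq_closure_inter`), semialgebraic by
`isSemialgebraic_closure`. Also: implicit differentiation `g' = -P_t/P_w` (`deriv_eq_neg_div`).

Sources: Bochnak–Coste–Roy, *Real Algebraic Geometry* (1998), §2.2, Prop. 8.1.8; Basu–Pollack–Roy,
*Algorithms in Real Algebraic Geometry* (2006), Thm. 5.21–5.22. Fully proved ([folklore]).
-/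

noncomputable section

open MvPolynomial Set Metric
open Literature.ModelTheory.ExponentialFields Literature.NumberTheory.Transcendental

namespace Summit.KontsevichZagierPeriods.ComplexOrientations.CauchyMoveAux

/-- The argument coordinate `t = z₀ + i z₁` of `z ∈ ℝ⁴ ≅ ℂ²` (local notation). -/
local notation:max "cxT " z:max => (Complex.mk (z 0) (z 1))

/-- The value coordinate `w = z₂ + i z₃` of `z ∈ ℝ⁴ ≅ ℂ²` (local notation). -/
local notation:max "cxW " z:max => (Complex.mk (z 2) (z 3))

/-- The complex point `(w, t) = (z₂ + i z₃, z₀ + i z₁) ∈ ℂ²` attached to `z ∈ ℝ⁴`: first the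
"value" coordinate `w`, then the "argument" coordinate `t` (local notation). -/
local notation:max "rho4 " z:max => (![Complex.mk (z 2) (z 3), Complex.mk (z 0) (z 1)] : Fin 2 → ℂ)

/-- The complex number `x₀ + i x₁` attached to a point `x ∈ ℝ²` (local notation). -/
local notation:max "cx " x:max => (Complex.mk (x 0) (x 1))

/-! ### The graph of an algebraic holomorphic function is semialgebraic -/

section Graph

open Filter Topology

variable {R₁ : ℚ} {g : ℂ → ℂ} {P : MvPolynomial (Fin 2) ℚ}

/-- The open cylinder `{‖t‖ < R₁} ⊆ ℝ⁴` is `ℚ`-semialgebraic. -/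
theorem isSemialgebraic_setOf_cxT_mem_ball (hR : 0 < R₁) :
    IsSemialgebraic ℚ {z : Fin 4 → ℝ | cxT z ∈ ball (0 : ℂ) R₁} := by
  have h := isSemialgebraic_setOf_eval_pos (k := ℚ) (R := ℝ)
    (C (R₁ ^ 2) - X 0 ^ 2 - X 1 ^ 2 : MvPolynomial (Fin 4) ℚ)
  convert h using 1
  ext z
  simp only [mem_setOf_eq, mem_ball, dist_zero_right, map_sub, map_pow, aeval_C, aeval_X,
    eq_ratCast, sub_pos]
  have hR' : (0 : ℝ) ≤ R₁ := by exact_mod_cast hR.le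
  rw [← sq_lt_sq₀ (norm_nonneg _) hR', Complex.sq_norm, Complex.normSq_mk]
  constructor <;> intro h <;> nlinarith [h]

/-- The open cylinder `{‖t‖ < R₁} ⊆ ℝ⁴` is open. -/
theorem isOpen_setOf_cxT_mem_ball : IsOpen {z : Fin 4 → ℝ | cxT z ∈ ball (0 : ℂ) R₁} :=
  isOpen_ball.preimage continuous_cxT

/-- **Local uniqueness of the branch** (holomorphic implicit function theorem): near a point of
the graph of `g` where `∂P/∂w ≠ 0`, every zero of `P` over the disc lies on the graph. -/
theorem exists_nhd_inter_subset (hg : DifferentiableOn ℂ g (ball 0 R₁))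
    (hPU : ∀ t ∈ ball (0 : ℂ) R₁, aeval ![g t, t] P = 0) {z : Fin 4 → ℝ}
    (hzb : cxT z ∈ ball (0 : ℂ) R₁) (hzw : cxW z = g (cxT z))
    (hzf : aeval ![g (cxT z), cxT z] (pderiv 0 P) ≠ 0) :
    ∃ N : Set (Fin 4 → ℝ), IsOpen N ∧ z ∈ N ∧
      ∀ y ∈ N, cxT y ∈ ball (0 : ℂ) R₁ → aeval (rho4 y) P = 0 → cxW y = g (cxT y) := by
  set Pc : MvPolynomial (Fin 2) ℂ := map (algebraMap ℚ ℂ) P with hPc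
  let E : Fin 1 ⊕ Fin 1 ≃ Fin 2 := (finSumFinEquiv : Fin 1 ⊕ Fin 1 ≃ Fin 2).trans (Equiv.swap 0 1)
  have hE1 : E (Sum.inl 0) = 1 := by decide
  have hE0 : E (Sum.inr 0) = 0 := by decide
  have hrz : rho4 z = ![g (cxT z), cxT z] := by rw [hzw]
  have hJ : (Matrix.of fun i j : Fin 1 => eval (rho4 z) (pderiv (E (Sum.inr i)) Pc)).det ≠ 0 := by
    rw [Matrix.det_unique, Matrix.of_apply]
    simp only [Fin.default_eq_zero, hE0, hPc, pderiv_map, ← aeval_eq_eval_map, hrz]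
    exact hzf
  obtain ⟨Ω, T, ψ, hΩ, hzΩ, -, -, huniq, -⟩ :=
    Literature.NumberTheory.Transcendental.exists_implicitChart E (fun _ : Fin 1 => Pc) (rho4 z) hJ
  set O : Set (Fin 4 → ℝ) := {y | cxT y ∈ ball (0 : ℂ) R₁} with hO
  set γ : (Fin 4 → ℝ) → (Fin 2 → ℂ) := fun y => ![g (cxT y), cxT y] with hγ
  have hγc : ContinuousOn γ O := by
    refine continuousOn_pi.2 fun i => ?_
    fin_cases i
    · exact (hg.continuousOn.comp continuous_cxT.continuousOn fun y hy => hy)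
    · exact continuous_cxT.continuousOn
  refine ⟨(fun z => rho4 z) ⁻¹' Ω ∩ (O ∩ γ ⁻¹' Ω), (hΩ.preimage continuous_rho4).inter
    (hγc.isOpen_inter_preimage isOpen_setOf_cxT_mem_ball hΩ), ⟨hzΩ, hzb, ?_⟩, ?_⟩
  · show (![g (cxT z), cxT z] : Fin 2 → ℂ) ∈ Ω
    rw [← hrz]
    exact hzΩ
  · rintro y ⟨hyΩ, hyb, hyγ⟩ - hyP
    have h1 := (huniq (rho4 y) hyΩ fun _ => by
      rw [hPc, ← aeval_eq_eval_map]; exact hyP).2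
    have h2 := (huniq (γ y) hyγ fun _ => by
      rw [hPc, ← aeval_eq_eval_map, hγ]; exact hPU _ hyb).2
    have harg : (fun t : Fin 1 => rho4 y (E (Sum.inl t))) = fun t => γ y (E (Sum.inl t)) := by
      funext t
      rw [Subsingleton.elim t 0, hE1]
      simp [hγ]
    have h12 : rho4 y = γ y :=
      calc rho4 y = ψ (fun t : Fin 1 => rho4 y (E (Sum.inl t))) := h1.symm
        _ = ψ (fun t => γ y (E (Sum.inl t))) := by rw [harg]
        _ = γ y := h2
    have := congr_fun h12 0
    simpa [hγ] using this

/-- **The graph off the ramification locus is semialgebraic**: the part of the graph of `g` over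
`{t ∈ disc | ∂P/∂w (g t, t) ≠ 0}` is a union of connected components (cells) of the
`ℚ`-semialgebraic set `{P = 0, ∂P/∂w ≠ 0}` over the disc. -/
theorem isSemialgebraic_graph_off (hR : 0 < R₁) (hg : DifferentiableOn ℂ g (ball 0 R₁))
    (hPU : ∀ t ∈ ball (0 : ℂ) R₁, aeval ![g t, t] P = 0) :
    IsSemialgebraic ℚ {z : Fin 4 → ℝ | cxT z ∈ {t | t ∈ ball (0 : ℂ) R₁ ∧
      aeval ![g t, t] (pderiv 0 P) ≠ 0} ∧ cxW z = g (cxT z)} := by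
  set f : ℂ → ℂ := fun t => aeval ![g t, t] (pderiv 0 P) with hf
  set O : Set (Fin 4 → ℝ) := {y | cxT y ∈ ball (0 : ℂ) R₁} with hO
  set X' : Set (Fin 4 → ℝ) :=
    O ∩ ({z | aeval (rho4 z) P = 0} ∩ {z | aeval (rho4 z) (pderiv 0 P) ≠ 0}) with hX'
  set Γ' : Set (Fin 4 → ℝ) :=
    {z | cxT z ∈ {t | t ∈ ball (0 : ℂ) R₁ ∧ f t ≠ 0} ∧ cxW z = g (cxT z)} with hΓ'
  have hX's : IsSemialgebraic ℚ X' := (isSemialgebraic_setOf_cxT_mem_ball hR).inter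
    ((isSemialgebraic_setOf_aeval_rho4_eq_zero P).inter
      (isSemialgebraic_setOf_aeval_rho4_ne_zero _))
  have hrho : ∀ z : Fin 4 → ℝ, cxW z = g (cxT z) → rho4 z = ![g (cxT z), cxT z] := fun z hz => by
    rw [hz]
  have hΓ'X' : Γ' ⊆ X' := by
    rintro z ⟨⟨hzb, hzf⟩, hzw⟩
    exact ⟨hzb, by rw [mem_setOf_eq, hrho z hzw]; exact hPU _ hzb,
      by rw [mem_setOf_eq, hrho z hzw]; exact hzf⟩
  -- the open set `v` cutting out the complement of the graph
  set Fd : (Fin 4 → ℝ) → ℂ := fun z => cxW z - g (cxT z) with hFd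
  have hFdc : ContinuousOn Fd O :=
    continuous_cxW.continuousOn.sub (hg.continuousOn.comp continuous_cxT.continuousOn fun y hy => hy)
  set v : Set (Fin 4 → ℝ) := O ∩ Fd ⁻¹' {0}ᶜ with hv
  have hvo : IsOpen v := hFdc.isOpen_inter_preimage isOpen_setOf_cxT_mem_ball isOpen_compl_singleton
  -- the open set `u` with `u ∩ X' ⊆ Γ'` (implicit function theorem)
  have hchart : ∀ z ∈ Γ', ∃ N : Set (Fin 4 → ℝ), IsOpen N ∧ z ∈ N ∧ N ∩ X' ⊆ Γ' := by
    rintro z ⟨⟨hzb, hzf⟩, hzw⟩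
    obtain ⟨N, hN, hzN, hNX⟩ := exists_nhd_inter_subset hg hPU hzb hzw hzf
    refine ⟨N, hN, hzN, ?_⟩
    rintro y ⟨hyN, hyb, hyP, hyf⟩
    have hyw : cxW y = g (cxT y) := hNX y hyN hyb hyP
    refine ⟨⟨hyb, ?_⟩, hyw⟩
    have h' : aeval (rho4 y) (pderiv 0 P) ≠ 0 := hyf
    rwa [hrho y hyw] at h'
  choose! N hN using hchart
  set u : Set (Fin 4 → ℝ) := ⋃ z ∈ Γ', N z with hu
  have huo : IsOpen u := isOpen_biUnion fun z hz => (hN z hz).1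
  have hΓ'u : Γ' ⊆ u := fun z hz => mem_biUnion hz (hN z hz).2.1
  have huX' : u ∩ X' ⊆ Γ' := by
    rintro y ⟨hy, hyX⟩
    obtain ⟨z, hz, hyz⟩ := mem_iUnion₂.1 hy
    exact (hN z hz).2.2 ⟨hyz, hyX⟩
  have hX'uv : X' ⊆ u ∪ v := by
    intro x hxX
    by_cases hx : cxW x = g (cxT x)
    · refine Or.inl (hΓ'u ⟨⟨hxX.1, ?_⟩, hx⟩)
      have h' : aeval (rho4 x) (pderiv 0 P) ≠ 0 := hxX.2.2
      rwa [hrho x hx] at h'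
    · exact Or.inr ⟨hxX.1, by simpa [hFd, sub_eq_zero] using hx⟩
  -- `Γ'` is a union of cells of `X'`
  obtain ⟨𝒞, h𝒞, hU𝒞⟩ := hX's.exists_finset_isConnected_sUnion_eq
  have hΓ'eq : Γ' = ⋃₀ {C ∈ (𝒞 : Set (Set (Fin 4 → ℝ))) | (C ∩ Γ').Nonempty} := by
    apply Subset.antisymm
    · intro z hz
      have hzX : z ∈ ⋃₀ (𝒞 : Set (Set (Fin 4 → ℝ))) := hU𝒞 ▸ hΓ'X' hz
      obtain ⟨C, hC, hzC⟩ := mem_sUnion.1 hzX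
      exact mem_sUnion.2 ⟨C, ⟨hC, z, hzC, hz⟩, hzC⟩
    · rintro z ⟨C, ⟨hC, y, hyC, hyΓ⟩, hzC⟩
      have hCX : C ⊆ X' := hU𝒞 ▸ subset_sUnion_of_mem hC
      have hCpre : IsPreconnected C := (h𝒞 C hC).2.isPreconnected
      have hdisj : C ∩ (u ∩ v) = ∅ := by
        refine eq_empty_of_forall_notMem fun x hx => hx.2.2.2 ?_
        have hxΓ := huX' ⟨hx.2.1, hCX hx.1⟩
        show Fd x ∈ ({0} : Set ℂ)
        simp [hFd, hxΓ.2]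
      rcases (isPreconnected_iff_subset_of_disjoint.1 hCpre) u v huo hvo
        (hCX.trans hX'uv) hdisj with hCu | hCv
      · exact huX' ⟨hCu hzC, hCX hzC⟩
      · exact absurd (show Fd y ∈ ({0} : Set ℂ) by simp [hFd, hyΓ.2]) (hCv hyC).2
  rw [hΓ'eq]
  exact isSemialgebraic_sUnion_sep (fun C hC => (h𝒞 C hC).1) _

end Graph


section Closure

open Filter Topology

variable {R₁ : ℚ} {g : ℂ → ℂ} {P : MvPolynomial (Fin 2) ℚ}

/-- **Density of the good locus**: if `∂P/∂w (g t, t)` does not vanish identically on the disc,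
its non-vanishing locus is dense in the disc (identity principle). -/
theorem dense_good (hg : DifferentiableOn ℂ g (ball 0 R₁))
    (hgood : ∃ t₁ ∈ ball (0 : ℂ) R₁, aeval ![g t₁, t₁] (pderiv 0 P) ≠ 0) :
    ball (0 : ℂ) R₁ ⊆ closure {t | t ∈ ball (0 : ℂ) R₁ ∧ aeval ![g t, t] (pderiv 0 P) ≠ 0} := by
  obtain ⟨t₁, ht₁, hPt₁⟩ := hgood
  set f : ℂ → ℂ := fun t => aeval ![g t, t] (pderiv 0 P) with hf
  have hgan : AnalyticOnNhd ℂ g (ball 0 R₁) := hg.analyticOnNhd isOpen_ball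
  have hfan : AnalyticOnNhd ℂ f (ball 0 R₁) := by
    refine AnalyticOnNhd.aeval_mvPolynomial (fun i => ?_) (pderiv 0 P)
    fin_cases i
    · exact hgan
    · exact analyticOnNhd_id
  intro t₀ ht₀
  rcases (hfan t₀ ht₀).eventually_eq_zero_or_eventually_ne_zero with h | h
  · exact absurd ((hfan.eqOn_zero_of_preconnected_of_eventuallyEq_zero
      (convex_ball 0 R₁).isPreconnected ht₀ h) ht₁) hPt₁
  · rw [mem_closure_iff_frequently]
    have h2 : ∀ᶠ z in 𝓝[≠] t₀, z ∈ ball (0 : ℂ) R₁ ∧ f z ≠ 0 :=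
      (eventually_nhdsWithin_of_eventually_nhds (isOpen_ball.mem_nhds ht₀)).and h
    exact h2.frequently.filter_mono nhdsWithin_le_nhds

/-- **Closure trick**: the graph of a continuous `h` over an open `O` is recovered from its graph
over any dense `S ⊆ O` as `closure (graph|_S) ∩ (O × ℂ)`. -/
theorem graph_eq_closure_inter {O S : Set ℂ} (hO : IsOpen O) {h : ℂ → ℂ} (hh : ContinuousOn h O)
    (hSO : S ⊆ O) (hdense : O ⊆ closure S) :
    {z : Fin 4 → ℝ | cxT z ∈ O ∧ cxW z = h (cxT z)} =
      closure {z : Fin 4 → ℝ | cxT z ∈ S ∧ cxW z = h (cxT z)} ∩ {z | cxT z ∈ O} := by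
  apply Subset.antisymm
  · rintro z ⟨hzO, hzw⟩
    refine ⟨?_, hzO⟩
    set φ : ℂ → (Fin 4 → ℝ) := fun t => ![t.re, t.im, (h t).re, (h t).im] with hφ
    have hφc : ContinuousOn φ O := by
      refine continuousOn_pi.2 fun i => ?_
      fin_cases i
      · exact Complex.continuous_re.continuousOn
      · exact Complex.continuous_im.continuousOn
      · exact Complex.continuous_re.comp_continuousOn hh
      · exact Complex.continuous_im.comp_continuousOn hh
    have hφz : φ (cxT z) = z := by
      ext i
      fin_cases i
      · rfl
      · rfl
      · simp [hφ, ← hzw]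
      · simp [hφ, ← hzw]
    have himg : φ '' S ⊆ {z : Fin 4 → ℝ | cxT z ∈ S ∧ cxW z = h (cxT z)} := by
      rintro _ ⟨t, ht, rfl⟩
      have h1 : cxT (φ t) = t := Complex.ext rfl rfl
      refine ⟨by rw [h1]; exact ht, ?_⟩
      rw [h1]
      exact Complex.ext rfl rfl
    rw [← hφz]
    exact closure_mono himg
      (((hφc _ hzO).mono hSO).mem_closure_image (hdense hzO))
  · rintro z ⟨hzc, hzO⟩
    refine ⟨hzO, ?_⟩
    by_contra hne
    set Fd : (Fin 4 → ℝ) → ℂ := fun y => cxW y - h (cxT y) with hFd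
    have hFdc : ContinuousOn Fd {y | cxT y ∈ O} :=
      continuous_cxW.continuousOn.sub (hh.comp continuous_cxT.continuousOn fun y hy => hy)
    have hWo : IsOpen ({y : Fin 4 → ℝ | cxT y ∈ O} ∩ Fd ⁻¹' {0}ᶜ) :=
      hFdc.isOpen_inter_preimage (hO.preimage continuous_cxT) isOpen_compl_singleton
    obtain ⟨y, ⟨-, hyF⟩, hyS⟩ := (_root_.mem_closure_iff.1 hzc) _ hWo
      ⟨hzO, by simpa [hFd, sub_eq_zero] using hne⟩
    exact hyF (by simp [hFd, hyS.2])

/-- **The graph of an algebraic holomorphic function over a rational disc is `ℚ`-semialgebraic.** -/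
theorem isSemialgebraic_graph (hR : 0 < R₁) (hg : DifferentiableOn ℂ g (ball 0 R₁))
    (hP : ∃ P : MvPolynomial (Fin 2) ℚ, P ≠ 0 ∧ ∀ t ∈ ball (0 : ℂ) R₁, aeval ![g t, t] P = 0) :
    IsSemialgebraic ℚ {z : Fin 4 → ℝ | cxT z ∈ ball (0 : ℂ) R₁ ∧ cxW z = g (cxT z)} := by
  obtain ⟨P, hPU, hgood⟩ := exists_goodPoly isOpen_ball
    ⟨0, mem_ball_self (by exact_mod_cast hR)⟩ g hP
  rw [graph_eq_closure_inter isOpen_ball hg.continuousOn (fun t ht => ht.1) (dense_good hg hgood)]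
  exact (isSemialgebraic_closure (isSemialgebraic_graph_off hR hg hPU)).inter
    (isSemialgebraic_setOf_cxT_mem_ball hR)

/-- **Implicit differentiation**: `g' = -P_t / P_w` along the graph, off the ramification locus. -/
theorem deriv_eq_neg_div (hg : DifferentiableOn ℂ g (ball 0 R₁))
    (hPU : ∀ t ∈ ball (0 : ℂ) R₁, aeval ![g t, t] P = 0) {t : ℂ} (ht : t ∈ ball (0 : ℂ) R₁)
    (hne : aeval ![g t, t] (pderiv 0 P) ≠ 0) :
    deriv g t = -aeval ![g t, t] (pderiv 1 P) / aeval ![g t, t] (pderiv 0 P) := by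
  set Pc : MvPolynomial (Fin 2) ℂ := map (algebraMap ℚ ℂ) P with hPc
  set γ : ℂ → Fin 2 → ℂ := fun t => ![g t, t] with hγ
  have hgd : HasDerivAt g (deriv g t) t :=
    (hg.differentiableAt (isOpen_ball.mem_nhds ht)).hasDerivAt
  have hγd : HasDerivAt γ ![deriv g t, 1] t := by
    refine hasDerivAt_pi.2 fun i => ?_
    fin_cases i
    · exact hgd
    · exact hasDerivAt_id t
  have hcomp := (Literature.NumberTheory.Transcendental.hasFDerivAt_eval Pc (γ t)).comp_hasDerivAt
    t hγd
  have hzero : HasDerivAt (fun t => eval (γ t) Pc) 0 t := by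
    refine (hasDerivAt_const t (0 : ℂ)).congr_of_eventuallyEq ?_
    filter_upwards [isOpen_ball.mem_nhds ht] with s hs
    rw [hPc, ← aeval_eq_eval_map, hγ]
    exact hPU s hs
  have h := hcomp.unique hzero
  have key : eval (γ t) (pderiv 0 Pc) * deriv g t + eval (γ t) (pderiv 1 Pc) = 0 := by
    simpa [Fin.sum_univ_two] using h
  rw [hPc, pderiv_map, pderiv_map, ← aeval_eq_eval_map, ← aeval_eq_eval_map] at key
  change aeval ![g t, t] (pderiv 0 P) * deriv g t + aeval ![g t, t] (pderiv 1 P) = 0 at key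
  field_simp
  linear_combination key

end Closure

end Summit.KontsevichZagierPeriods.ComplexOrientations.CauchyMoveAux
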